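import Summits.BirchSwinnertonDyer.Rank1Residual.Iwasawa.NonsingularReductionTowerInputs
import Literature.NumberTheory.GaloisRepresentations.InertiaCohomologyFinite
import Literature.NumberTheory.EllipticCurves.KodairaNeronUnramifiedInertiaProofs
import HarnessLib

/-!
# BSD rank-≤1 residual cell — the non-split local tower is PRIME-TO-`p` over inertia, and
# restriction to inertia is injective on `H¹(K_{∞,η}, B)` for finite `p`-primary `B` (TOOL; row T-NSP)

HONEST FRAMING (cell `b2b-bsdres-*`, team n1011, verbatim): prove what is provable now; shrink each
hard class to its core with data; no claim beyond stated classes. Research route; TOOL theorems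
only — no definition, no named fact, nothing booked, no residual-map mark moved, no class closed.
Row T-NSP of `cells/n1011/OWNERS.md` (seat n1011-p12 GEN 12; idle rule R3-25 (f)): a stand-alone
K-general TOOL with NO current END of the cell binding it (consumer honesty: these are the first
bricks of the local structure of `𝓗_v(K_∞) = H¹(K_{∞,η}, E[p^∞])` at `v ∤ p` — Greenberg–Vatsal
2000 §2, Greenberg LNM 1716 §§2–3 — which any kernel λ-shift statement over `ℚ_∞` must consume).

SETTING. `K` a number field, `E`-free: `p` prime, `κ` ANY `ℤ_p`-extension of `K`, `v ∤ p` a finite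
place (`hpv`), `K_v = v.adicCompletion K`, `Γ_{K_v}` its absolute Galois group,
`Hi = localSubgroup κ.kerSubgroup K_v = Gal(K̄_v/K_{∞,η})` (`SubgroupSelmer`), `𝔐` a prime of the
local absolute integers above `𝓂_v` and `I_𝔐 = 𝔐.inertia Γ_{K_v}` its inertia group
(`= absInertia K_v`, tree `inertia_eq_absInertia`; `I_𝔐 ≤ Hi` because `ℤ_p`-extensions are
unramified outside `p`, `ZpExtension.inertia_le_kerSubgroup_holds`), and the NON-SPLIT hypothesis
`hns : ∃ σ ∈ Γ_{K_v}, σ ∉ Hi` (`v` not split completely in `K_∞/K`; automatic for the cyclotomic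
`κ`, `NonsingularTower.exists_not_mem_localSubgroup_of_isCyclotomic`).

* `relIndex_sup_inertia_coprime` — **`p ∤ [Hi : Hi ∩ N·I_𝔐]` for every open normal `N ≤ Γ_{K_v}`**:
  the quotient `Γ_{K_v}/(N·I_𝔐)` is cyclic, generated by an arithmetic Frobenius `F` (tree
  `exists_eq_frobenius_pow_mul_inertia_mul`, `exists_isArithFrobAt_localAbsIntegers`); reading the
  local character `κ ∘ (Γ_{K_v} → Γ_K)` (zero on `Hi` and `I_𝔐`, `= p^m·unit ≠ 0` at `F` by `hns`)
  on `h = Fⁿ·τ·u` with `u ∈ N·I_𝔐 ∩ H_{v,m+r}` gives `p^r ∣ n`, so the image of `Hi` lies in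
  `⟨F̄^(p^r)⟩`, `p^r` the `p`-part of `ord F̄`, a group of order prime to `p`. This is Greenberg's
  "`Δ = Gal(F_v(E[p^∞])/K)` is a finite cyclic group of order prime to `p`" (LNM 1716, §3 p. 87) and
  Coates' "the profinite degree of `F_v^{nr}` over `K_∞` is prime to `p`" (LNM 1716, proof of
  Lemma 3.8), as a statement about `Hi/I_𝔐` alone.
* `resSubgroup_inertia_injective`, `resOfLe_inertia_injective` — **for every FINITE `p`-PRIMARY
  discrete `Γ_{K_v}`-module `B`, the restriction `H¹(Hi, B) → H¹(I_𝔐, B)` is injective** (in the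
  tree's `ResKernel.resSubgroup` currency for the normal subgroup `I_𝔐` of `Hi`, and in the
  `resOfLe` currency of `IwasawaSelmerControlLocalizationProofs`): a kernel class has a continuous
  cocycle `c : Hi → B` vanishing on `I_𝔐` (`ResKernel.exists_cocycle_of_res_eq_zero`); its zero set
  is an open subgroup of `Hi` (`ResKernel.zeroSubgroup`), hence contains `Hi ∩ N` for an open normal
  `N ≤ Γ_{K_v}` (`ProfiniteGrp.exist_openNormalSubgroup_sub_open_nhds_of_one`), so `c` is constant
  on the cosets of `Hi ∩ N·I_𝔐`; with `m = [Hi : Hi ∩ N·I_𝔐]` (prime to `p`) and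
  `S = Σ_q c(q)` over `Hi/(Hi ∩ N·I_𝔐)`: `m•c(h) = S − h•S`, so `c = ∂(−m′•S)` (`m m′ ≡ 1 mod p^k`).
* `finite_subgroupH1_and_natCard_le` — **`H¹(K_{∞,η}, B)` is finite with `#H¹(Hi, B) ≤ #B`** when
  moreover `#B` is prime to the residue characteristic: injectivity above and the tree's bound
  `#H¹(I_{K_v}, B) ≤ #B` (`natCard_continuousCohomology_one_absInertia_le`, through the definitional
  bridge `ContinuousRep.toTopRep = discreteTopRep` of `Iwasawa/InertiaCohomologyPTorsionFinite`).
  For `B = E[p]` this is the finiteness of `H¹(K_{∞,η}, E[p])`, i.e. of the `p`-torsion of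
  Greenberg's `𝓗_v(K_∞)` at a finitely decomposed `v ∤ p` (Greenberg–Vatsal 2000 §2).

NOT claimed: the split-completely case (`Hi = Γ_{K_v}`, where `H¹(Γ_{K_v}/I, ·) ≠ 0` in general);
`v ∣ p`; any `H²` / `cd_p` statement (the Brauer-group input is not in the tree; in particular
p05's named fact `Greenberg1999.localH1_primaryTorsion_divisible_cyclotomic` is NOT discharged by
this row); coranks. Axioms standard.

References: [GreenbergLNM1716] Greenberg §2–§3 (Lemma 3.3, proof, p. 87), Coates §3 (Lemma 3.8);
Greenberg–Vatsal, Invent. Math. 142 (2000), §2; [SerreGaloisCohomology1997] I.§2, I.§5.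
-/

noncomputable section

open scoped Classical NNReal
open NumberField IsDedekindDomain Field ValuativeRel

universe u

namespace Summit.BirchSwinnertonDyer.Rank1Residual.Iwasawa.NonsplitTower

open Literature.NumberTheory.EllipticCurves Literature.NumberTheory.GaloisRepresentations
  IsDedekindDomain.HeightOneSpectrum ContinuousCohomology
  Summit.BirchSwinnertonDyer.Rank1Residual.Iwasawa.NonsingularTower

variable {K : Type u} [Field K] [NumberField K]
  {v : HeightOneSpectrum (𝓞 K)} {p : ℕ} [Fact p.Prime] (κ : ZpExtension K p)

/-- **The image of `Hi = Gal(K̄_v/K_{∞,η})` in every finite quotient `Γ_{K_v}/(N·I_𝔐)` (`N` open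
normal) has order prime to `p`**, when `v ∤ p` is not split completely in the `ℤ_p`-extension:
`p ∤ [Hi : Hi ∩ N·I_𝔐]`. [cite: GreenbergLNM1716, §3 Lemma 3.3 (proof, p. 87)] -/
theorem relIndex_sup_inertia_coprime (hpv : (p : 𝓞 K) ∉ v.asIdeal)
    (hns : ∃ σ : absoluteGaloisGroup (v.adicCompletion K),
      σ ∉ localSubgroup κ.kerSubgroup (v.adicCompletion K))
    {𝔐 : Ideal v.localAbsIntegers} (h𝔐 : 𝔐 ∈ v.localPrimesAbove)
    (N : Subgroup (absoluteGaloisGroup (v.adicCompletion K))) [N.Normal]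
    (hN : IsOpen (N : Set (absoluteGaloisGroup (v.adicCompletion K)))) :
    ((N ⊔ 𝔐.inertia (absoluteGaloisGroup (v.adicCompletion K))).relIndex
      (localSubgroup κ.kerSubgroup (v.adicCompletion K))).Coprime p := by
  -- notation
  let G : Type u := absoluteGaloisGroup (v.adicCompletion K)
  let Hi : Subgroup G := localSubgroup κ.kerSubgroup (v.adicCompletion K)
  let I : Subgroup G := 𝔐.inertia G
  have hp : (p : ℕ).Prime := Fact.out
  haveI : CharZero (v.adicCompletion K) :=
    charZero_of_injective_algebraMap (algebraMap K (v.adicCompletion K)).injective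
  haveI hIn : I.Normal := v.inertia_normal_of_mem_localPrimesAbove h𝔐
  let M : Subgroup G := N ⊔ I
  haveI hMn : M.Normal := Subgroup.sup_normal N I
  have hMopen : IsOpen (M : Set G) := Subgroup.isOpen_mono (le_sup_left : N ≤ M) hN
  -- the local character
  let lam : G → ℤ_[p] := fun x ↦ (κ (resGal (K := K) (v.adicCompletion K) x)).toAdd
  have hlam_mul : ∀ x y : G, lam (x * y) = lam x + lam y := fun x y ↦ by
    show (κ (resGal (K := K) _ (x * y))).toAdd = (κ (resGal (K := K) _ x)).toAdd +
      (κ (resGal (K := K) _ y)).toAdd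
    rw [map_mul, map_mul, toAdd_mul]
  have hlam_pow : ∀ (x : G) (n : ℕ), lam (x ^ n) = (n : ℤ_[p]) * lam x := fun x n ↦ by
    show (κ (resGal (K := K) _ (x ^ n))).toAdd = (n : ℤ_[p]) * (κ (resGal (K := K) _ x)).toAdd
    rw [map_pow, map_pow, toAdd_pow, nsmul_eq_mul]
  have hlam_Hi : ∀ x : G, x ∈ Hi ↔ lam x = 0 := fun x ↦ by
    show x ∈ localSubgroup κ.kerSubgroup (v.adicCompletion K) ↔ _
    rw [mem_localSubgroup_iff, ZpExtension.mem_kerSubgroup]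
    constructor
    · intro h
      show (κ (resGal (K := K) _ x)).toAdd = 0
      rw [h, toAdd_one]
    · intro h
      exact Multiplicative.toAdd.injective (by rw [toAdd_one]; exact h)
  have hlam_layer : ∀ (x : G) (n : ℕ),
      x ∈ localSubgroup (κ.layerSubgroup n) (v.adicCompletion K) ↔ (p : ℤ_[p]) ^ n ∣ lam x :=
    fun x n ↦ by rw [mem_localSubgroup_iff, ZpExtension.mem_layerSubgroup]
  have hI : ∀ σ ∈ I, σ ∈ Hi := fun σ hσ ↦
    (mem_localSubgroup_iff _ _ σ).mpr
      (ZpExtension.inertia_le_kerSubgroup_holds K p κ hpv (primeBelow_mem_primesAbove h𝔐)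
        (v.resGalOfEmb_mem_inertia_primeBelow (closureEmb (K := K) (v.adicCompletion K)) 𝔐 hσ))
  -- Frobenius; `λ F ≠ 0`
  obtain ⟨F, hF⟩ := v.exists_isArithFrobAt_localAbsIntegers h𝔐
  have hlamF : lam F ≠ 0 := by
    intro h0
    obtain ⟨σ₀, hσ₀⟩ := hns
    apply hσ₀
    rw [hlam_Hi]
    apply padicInt_eq_zero_of_forall_pow_dvd (p := p)
    intro n
    obtain ⟨k, τ, u, hτ, hu, rfl⟩ := v.exists_eq_frobenius_pow_mul_inertia_mul h𝔐 hF
      (isOpen_localSubgroup_layerSubgroup (v.adicCompletion K) κ n) σ₀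
    rw [hlam_mul, hlam_mul, hlam_pow, h0, mul_zero, zero_add, (hlam_Hi τ).mp (hI τ hτ), zero_add]
    exact (hlam_layer u n).mp hu
  obtain ⟨m, uF, huF⟩ : ∃ (m : ℕ) (uF : ℤ_[p]ˣ), lam F = (uF : ℤ_[p]) * (p : ℤ_[p]) ^ m :=
    ⟨(lam F).valuation, PadicInt.unitCoeff hlamF, PadicInt.unitCoeff_spec hlamF⟩
  -- the finite cyclic quotient `Ḡ = G/M`, generated by `F̄`
  let π : G →* G ⧸ M := QuotientGroup.mk' M
  haveI : Finite (G ⧸ M) := Subgroup.quotient_finite_of_isOpen M hMopen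
  -- the `p`-part of the order of `F̄`
  obtain ⟨r, e', he', hee'⟩ := Nat.exists_eq_pow_mul_and_not_dvd (orderOf_pos (π F)).ne' p
    hp.ne_one
  -- every `h ∈ Hi` maps into `⟨F̄^(p^r)⟩`
  have hmem : ∀ h ∈ Hi, π h ∈ Subgroup.zpowers (π F ^ (p ^ r)) := by
    intro h hh
    have hUopen : IsOpen ((M ⊓ localSubgroup (κ.layerSubgroup (m + r)) (v.adicCompletion K) :
        Subgroup G) : Set G) := by
      rw [Subgroup.coe_inf]
      exact hMopen.inter (isOpen_localSubgroup_layerSubgroup (v.adicCompletion K) κ (m + r))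
    obtain ⟨n, τ, u, hτ, hu, rfl⟩ := v.exists_eq_frobenius_pow_mul_inertia_mul h𝔐 hF hUopen h
    obtain ⟨hu1, hu2⟩ := Subgroup.mem_inf.mp hu
    have hdvd : (p : ℤ_[p]) ^ (m + r) ∣ (n : ℤ_[p]) * lam F := by
      have h0 : lam (F ^ n * τ * u) = 0 := (hlam_Hi _).mp hh
      rw [hlam_mul, hlam_mul, hlam_pow, (hlam_Hi τ).mp (hI τ hτ), add_zero] at h0
      have : (n : ℤ_[p]) * lam F = -lam u := eq_neg_of_add_eq_zero_left h0
      rw [this, dvd_neg]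
      exact (hlam_layer u (m + r)).mp hu2
    rw [huF, pow_add, ← mul_assoc] at hdvd
    have hp0 : (p : ℤ_[p]) ≠ 0 := by exact_mod_cast hp.ne_zero
    rw [mul_comm ((p : ℤ_[p]) ^ m)] at hdvd
    have h1 : (p : ℤ_[p]) ^ r ∣ (n : ℤ_[p]) * (uF : ℤ_[p]) :=
      (mul_dvd_mul_iff_right (pow_ne_zero m hp0)).mp hdvd
    have h2 : (p : ℤ_[p]) ^ r ∣ (n : ℤ_[p]) := (Units.dvd_mul_right).mp h1
    obtain ⟨c, hc⟩ := (pow_dvd_natCast_padicInt_iff (p := p) r n).mp h2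
    have hτ1 : π τ = 1 := (QuotientGroup.eq_one_iff τ).mpr (Subgroup.mem_sup_right hτ)
    have hu1' : π u = 1 := (QuotientGroup.eq_one_iff u).mpr hu1
    rw [map_mul, map_mul, map_pow, hτ1, hu1', mul_one, mul_one, hc, pow_mul]
    exact ⟨c, by simp only [zpow_natCast]⟩
  -- the image of `Hi` has order dividing `ord(F̄^(p^r)) = e'`, which is prime to `p`
  let φ : Hi →* G ⧸ M := π.comp Hi.subtype
  have hker : φ.ker = M.subgroupOf Hi := by
    ext x
    rw [MonoidHom.mem_ker, Subgroup.mem_subgroupOf, MonoidHom.comp_apply, Subgroup.coe_subtype,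
      QuotientGroup.mk'_apply, QuotientGroup.eq_one_iff]
  have hrange : φ.range ≤ Subgroup.zpowers (π F ^ (p ^ r)) := by
    rintro _ ⟨h, rfl⟩
    exact hmem h h.2
  have hidx : M.relIndex Hi = Nat.card φ.range := by
    rw [Subgroup.relIndex, ← hker, Subgroup.index_ker]
  have hcardC : Nat.card (Subgroup.zpowers (π F ^ (p ^ r))) = e' := by
    rw [Nat.card_zpowers, orderOf_pow' _ (pow_ne_zero r hp.ne_zero), hee',
      Nat.gcd_mul_right_left, Nat.mul_div_cancel_left _ (pow_pos hp.pos r)]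
  have hdvd : M.relIndex Hi ∣ e' := by
    rw [hidx, ← hcardC]
    exact Subgroup.card_dvd_of_le hrange
  have hcop : e'.Coprime p := ((Nat.Prime.coprime_iff_not_dvd hp).mpr he').symm
  exact hcop.coprime_dvd_left hdvd

/-- **Restriction to inertia is injective on `H¹(K_{∞,η}, B)` for a finite `p`-primary `B`**
(`v ∤ p` not split completely in the `ℤ_p`-extension). For every finite `p`-primary discrete
`Γ_{K_v}`-module `B` the restriction `res : H¹(Hi, B) → H¹(I_𝔐, B)` (the tree's
`ResKernel.resSubgroup` for the normal subgroup `I_𝔐 ∩ Hi = I_𝔐` of `Hi`) is injective: a kernel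
class has a continuous cocycle representative `c : Hi → B` vanishing on `I_𝔐`
(`ResKernel.exists_cocycle_of_res_eq_zero`); its zero set is an open subgroup of `Hi`, so it contains
`Hi ∩ N` for an open normal `N ≤ Γ_{K_v}` (`ProfiniteGrp.exist_openNormalSubgroup_sub_open_nhds_of_one`)
and `c` is constant on the cosets of `Hi ∩ N·I_𝔐`; with `m = [Hi : Hi ∩ N·I_𝔐]` (prime to `p`,
`relIndex_sup_inertia_coprime`) and `S = Σ_{q} c(q)` over the finite quotient one has
`m•c(h) = S − h•S`, so `c = ∂(−m′•S)` for `m m′ ≡ 1 (mod p^k)`. (Greenberg–Vatsal 2000 §2 /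
Greenberg LNM 1716 §2: the step "`Δ` has order prime to `p`, so `H¹(Δ, ·) = 0` on `p`-primary
modules".) [cite: GreenbergLNM1716, §3 Lemma 3.3 (proof, p. 87)] -/
theorem resSubgroup_inertia_injective (hpv : (p : 𝓞 K) ∉ v.asIdeal)
    (hns : ∃ σ : absoluteGaloisGroup (v.adicCompletion K),
      σ ∉ localSubgroup κ.kerSubgroup (v.adicCompletion K))
    {𝔐 : Ideal v.localAbsIntegers} (h𝔐 : 𝔐 ∈ v.localPrimesAbove)
    {B : Type u} [AddCommGroup B] [DistribMulAction (absoluteGaloisGroup (v.adicCompletion K)) B]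
    [TopologicalSpace B] [DiscreteTopology B] [Finite B] (hB : ∃ k : ℕ, ∀ b : B, p ^ k • b = 0)
    (hcont : ∀ b : B, Continuous fun g : absoluteGaloisGroup (v.adicCompletion K) ↦ g • b) :
    Function.Injective (ResKernel.resSubgroup
      ((𝔐.inertia (absoluteGaloisGroup (v.adicCompletion K))).subgroupOf
        (localSubgroup κ.kerSubgroup (v.adicCompletion K))) B) := by
  -- notation
  let G : Type u := absoluteGaloisGroup (v.adicCompletion K)
  let Hi : Subgroup G := localSubgroup κ.kerSubgroup (v.adicCompletion K)
  let I : Subgroup G := 𝔐.inertia G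
  have hp : (p : ℕ).Prime := Fact.out
  haveI : CharZero (v.adicCompletion K) :=
    charZero_of_injective_algebraMap (algebraMap K (v.adicCompletion K)).injective
  haveI hIn : I.Normal := v.inertia_normal_of_mem_localPrimesAbove h𝔐
  have hI : ∀ σ ∈ I, σ ∈ Hi := fun σ hσ ↦
    (mem_localSubgroup_iff _ _ σ).mpr
      (ZpExtension.inertia_le_kerSubgroup_holds K p κ hpv (primeBelow_mem_primesAbove h𝔐)
        (v.resGalOfEmb_mem_inertia_primeBelow (closureEmb (K := K) (v.adicCompletion K)) 𝔐 hσ))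
  have hcontH : ∀ b : B, Continuous fun h : Hi ↦ h • b := fun b ↦
    (hcont b).comp continuous_subtype_val
  -- reduce to the kernel
  refine (injective_iff_map_eq_zero _).mpr fun x hx ↦ ?_
  obtain ⟨φ, rfl, hφI⟩ := ResKernel.exists_cocycle_of_res_eq_zero (I.subgroupOf Hi) B hcontH x hx
  -- an open normal `N ≤ G` with `Hi ∩ N` inside the zero set of `φ`
  have hZopen : IsOpen (ResKernel.zeroSubgroup φ : Set Hi) := ResKernel.isOpen_zeroSubgroup φ
  obtain ⟨V, hVopen, hV⟩ := isOpen_induced_iff.mp hZopen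
  have h1V : (1 : G) ∈ V := by
    have : (1 : Hi) ∈ (Subtype.val ⁻¹' V : Set Hi) := by
      rw [hV]; exact (ResKernel.zeroSubgroup φ).one_mem
    exact this
  obtain ⟨N, hN⟩ := ProfiniteGrp.exist_openNormalSubgroup_sub_open_nhds_of_one hVopen h1V
  have hNzero : ∀ h : Hi, (h : G) ∈ (N : Subgroup G) → φ.1 h = 0 := by
    intro h hh
    have : h ∈ (Subtype.val ⁻¹' V : Set Hi) := hN hh
    rw [hV] at this
    exact this
  -- `M = N·I`, and `φ` vanishes on `Hi ∩ M`
  let M : Subgroup G := (N : Subgroup G) ⊔ I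
  haveI hMn : M.Normal := Subgroup.sup_normal _ _
  have hMopen : IsOpen (M : Set G) :=
    Subgroup.isOpen_mono (le_sup_left : (N : Subgroup G) ≤ M) N.isOpen'
  have hMzero : ∀ x : Hi, (x : G) ∈ M → φ.1 x = 0 := by
    intro x hx
    have hx' : (x : G) ∈ ((M : Subgroup G) : Set G) := hx
    rw [Subgroup.normal_mul] at hx'
    obtain ⟨n, hn, τ, hτ, hnτ⟩ := Set.mem_mul.mp hx'
    have hτH : τ ∈ Hi := hI τ hτ
    have hnH : n ∈ Hi := by
      have : n = (x : G) * τ⁻¹ := by rw [← hnτ, mul_inv_cancel_right]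
      rw [this]; exact Hi.mul_mem x.2 (Hi.inv_mem hτH)
    have hx_eq : x = (⟨n, hnH⟩ : Hi) * ⟨τ, hτH⟩ := Subtype.ext hnτ.symm
    rw [hx_eq, φ.2, hNzero ⟨n, hnH⟩ hn, hφI ⟨τ, hτH⟩ (Subgroup.mem_subgroupOf.mpr hτ), map_zero,
      add_zero]
  have hconst : ∀ (h x : Hi), (x : G) ∈ M → φ.1 (h * x) = φ.1 h := by
    intro h x hx
    rw [φ.2, hMzero x hx, map_zero, add_zero]
  -- the finite quotient `Q = Hi / (Hi ∩ M)`, of order prime to `p`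
  let MH : Subgroup Hi := M.subgroupOf Hi
  haveI : MH.Normal := inferInstance
  have hHiclosed : IsClosed (Hi : Set G) := by
    show IsClosed ((localSubgroup κ.kerSubgroup (v.adicCompletion K) : Subgroup G) : Set G)
    exact κ.isClosed_kerSubgroup.preimage (map_continuous (resGal (K := K) (v.adicCompletion K)))
  haveI : CompactSpace Hi := isCompact_iff_compactSpace.mp hHiclosed.isCompact
  have hMHopen : IsOpen (MH : Set Hi) := hMopen.preimage continuous_subtype_val
  haveI : Finite (Hi ⧸ MH) := Subgroup.quotient_finite_of_isOpen MH hMHopen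
  haveI : Fintype (Hi ⧸ MH) := Fintype.ofFinite _
  have hcard : Nat.card (Hi ⧸ MH) = M.relIndex Hi := (Subgroup.index_eq_card MH).symm
  have hcop : (Nat.card (Hi ⧸ MH)).Coprime p := by
    rw [hcard]
    exact relIndex_sup_inertia_coprime κ hpv hns h𝔐 (N : Subgroup G) N.isOpen'
  -- the averaging sum
  let S : B := ∑ q : Hi ⧸ MH, φ.1 q.out
  have hout : ∀ (h : Hi) (q : Hi ⧸ MH), φ.1 ((QuotientGroup.mk h * q).out) = φ.1 h + h • φ.1 q.out := by
    intro h q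
    obtain ⟨x, hx⟩ := QuotientGroup.mk_out_eq_mul (s := MH) (h * q.out)
    have hq : (QuotientGroup.mk h : Hi ⧸ MH) * q = QuotientGroup.mk (h * q.out) := by
      rw [QuotientGroup.mk_mul, QuotientGroup.out_eq']
    rw [hq, hx, hconst _ _ (Subgroup.mem_subgroupOf.mp x.2), φ.2]
    rfl
  have hS : ∀ h : Hi, (Nat.card (Hi ⧸ MH)) • φ.1 h = S - h • S := by
    intro h
    have hsum : ∑ q : Hi ⧸ MH, φ.1 ((QuotientGroup.mk h * q).out) = S :=
      Fintype.sum_equiv (Equiv.mulLeft (QuotientGroup.mk h : Hi ⧸ MH)) _ _ (fun _ ↦ rfl)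
    simp only [hout, Finset.sum_add_distrib, Finset.sum_const, Finset.card_univ, ← Finset.smul_sum]
      at hsum
    rw [Nat.card_eq_fintype_card, eq_sub_iff_add_eq]
    exact hsum
  -- invert `m` modulo `p^k`
  obtain ⟨k, hk⟩ := hB
  obtain ⟨m', -, hm'⟩ := Nat.exists_mul_mod_eq_one_of_coprime (hcop.pow_right (k + 1))
    (Nat.one_lt_pow (Nat.succ_ne_zero k) hp.one_lt)
  have hmm' : ∀ b : B, (Nat.card (Hi ⧸ MH) * m') • b = b := by
    intro b
    obtain ⟨q, hq⟩ : ∃ q, Nat.card (Hi ⧸ MH) * m' = p ^ (k + 1) * q + 1 :=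
      ⟨Nat.card (Hi ⧸ MH) * m' / p ^ (k + 1), by
        have h := Nat.div_add_mod (Nat.card (Hi ⧸ MH) * m') (p ^ (k + 1)); rw [hm'] at h
        exact h.symm⟩
    rw [hq, add_smul, one_smul, mul_comm, mul_smul, pow_succ', mul_smul, hk, smul_zero, smul_zero,
      zero_add]
  -- `φ` is the coboundary of `-(m' • S)`
  rw [oneCocycleClass_eq_zero_iff]
  refine ⟨-(m' • S), fun h ↦ ?_⟩
  show φ.1 h = h • (-(m' • S)) - -(m' • S)
  rw [smul_neg, sub_neg_eq_add, neg_add_eq_sub, ← hmm' (φ.1 h), mul_comm, mul_smul, hS h, smul_sub,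
    smul_comm]

/-- **The same in the tree's `resOfLe` currency** (subgroups of the one ambient group `Γ_{K_v}`, as in
`IwasawaSelmerControlLocalizationProofs.localTowerKer`): the restriction
`resOfLe B (I_𝔐 ≤ Hi) : H¹(Hi, B) → H¹(I_𝔐, B)` is injective for every finite `p`-primary discrete
`Γ_{K_v}`-module `B`, at `v ∤ p` not split completely. [cite: GreenbergLNM1716, §3 Lemma 3.3 (proof, p. 87)] -/
theorem resOfLe_inertia_injective (hpv : (p : 𝓞 K) ∉ v.asIdeal)
    (hns : ∃ σ : absoluteGaloisGroup (v.adicCompletion K),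
      σ ∉ localSubgroup κ.kerSubgroup (v.adicCompletion K))
    {𝔐 : Ideal v.localAbsIntegers} (h𝔐 : 𝔐 ∈ v.localPrimesAbove)
    (hle : 𝔐.inertia (absoluteGaloisGroup (v.adicCompletion K)) ≤
      localSubgroup κ.kerSubgroup (v.adicCompletion K))
    {B : Type u} [AddCommGroup B] [DistribMulAction (absoluteGaloisGroup (v.adicCompletion K)) B]
    [TopologicalSpace B] [DiscreteTopology B] [Finite B] (hB : ∃ k : ℕ, ∀ b : B, p ^ k • b = 0)
    (hcont : ∀ b : B, Continuous fun g : absoluteGaloisGroup (v.adicCompletion K) ↦ g • b) :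
    Function.Injective (Literature.NumberTheory.EllipticCurves.resOfLe B hle) := by
  let G : Type u := absoluteGaloisGroup (v.adicCompletion K)
  let Hi : Subgroup G := localSubgroup κ.kerSubgroup (v.adicCompletion K)
  let I : Subgroup G := 𝔐.inertia G
  let N : Subgroup Hi := I.subgroupOf Hi
  -- `res_{Hi → I}` followed by the tautological identification `I.subgroupOf Hi ≃ I` is `resSubgroup`
  let j : N →ₜ* I :=
    { toFun := fun x ↦ ⟨((x : Hi) : G), Subgroup.mem_subgroupOf.mp x.2⟩
      map_one' := rfl
      map_mul' := fun _ _ ↦ rfl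
      continuous_toFun := (continuous_subtype_val.comp continuous_subtype_val).subtype_mk _ }
  have hcomp : (resH1Hom j (AddMonoidHom.id B) (fun _ _ ↦ rfl)).comp
      (Literature.NumberTheory.EllipticCurves.resOfLe B hle) = ResKernel.resSubgroup N B := by
    unfold Literature.NumberTheory.EllipticCurves.resOfLe ResKernel.resSubgroup
    rw [resH1Hom_comp]
    exact resH1Hom_congr (ContinuousMonoidHom.ext fun _ ↦ rfl) (AddMonoidHom.ext fun _ ↦ rfl) _ _
  have hinj := resSubgroup_inertia_injective κ hpv hns h𝔐 hB hcont
  rw [← hcomp, AddMonoidHom.coe_comp] at hinj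
  exact hinj.of_comp

/-- **`H¹(K_{∞,η}, B)` is finite, of order at most `#B`, for a finite `p`-primary discrete
`Γ_{K_v}`-module `B` of order prime to the residue characteristic**, at a finite `v ∤ p` not split
completely in the `ℤ_p`-extension: `#H¹(Hi, B) ≤ #H¹(I_𝔐, B) ≤ #B` (injectivity of restriction to
inertia, `resOfLe_inertia_injective`, and the tree's bound `natCard_continuousCohomology_one_absInertia_le`
for the inertia group of the local field `K_v`, `I_𝔐 = absInertia K_v` by `inertia_eq_absInertia`).
For `B = E[p]` this is the finiteness of `H¹(K_{∞,η}, E[p])` (Greenberg–Vatsal 2000, §2: the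
`p`-torsion of `𝓗_ℓ(ℚ_∞)` is finite; Greenberg LNM 1716 §2).
[cite: GreenbergLNM1716, §3 Lemma 3.3 (proof, p. 87)] -/
theorem finite_subgroupH1_and_natCard_le (hpv : (p : 𝓞 K) ∉ v.asIdeal)
    (hns : ∃ σ : absoluteGaloisGroup (v.adicCompletion K),
      σ ∉ localSubgroup κ.kerSubgroup (v.adicCompletion K))
    {B : Type u} [AddCommGroup B] [DistribMulAction (absoluteGaloisGroup (v.adicCompletion K)) B]
    [TopologicalSpace B] [DiscreteTopology B] [Finite B] (hB : ∃ k : ℕ, ∀ b : B, p ^ k • b = 0)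
    (hBcard : (Nat.card B).Coprime (ringChar 𝓀[v.adicCompletion K]))
    (hcont : ∀ b : B, Continuous fun g : absoluteGaloisGroup (v.adicCompletion K) ↦ g • b) :
    Finite (Literature.NumberTheory.EllipticCurves.subgroupH1
      (localSubgroup κ.kerSubgroup (v.adicCompletion K)) B) ∧
    Nat.card (Literature.NumberTheory.EllipticCurves.subgroupH1
      (localSubgroup κ.kerSubgroup (v.adicCompletion K)) B) ≤ Nat.card B := by
  let G : Type u := absoluteGaloisGroup (v.adicCompletion K)
  let Hi : Subgroup G := localSubgroup κ.kerSubgroup (v.adicCompletion K)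
  haveI : CharZero (v.adicCompletion K) :=
    charZero_of_injective_algebraMap (algebraMap K (v.adicCompletion K)).injective
  obtain ⟨w, hw⟩ := v.exists_spectralValuation
  obtain ⟨𝔐, h𝔐⟩ := v.localPrimesAbove_nonempty
  have hIeq : 𝔐.inertia G = absInertia (v.adicCompletion K) := v.inertia_eq_absInertia hw h𝔐
  have hle : 𝔐.inertia G ≤ Hi := fun σ hσ ↦
    (mem_localSubgroup_iff _ _ σ).mpr
      (ZpExtension.inertia_le_kerSubgroup_holds K p κ hpv (primeBelow_mem_primesAbove h𝔐)
        (v.resGalOfEmb_mem_inertia_primeBelow (closureEmb (K := K) (v.adicCompletion K)) 𝔐 hσ))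
  -- `B` as a `ContinuousRep` of `Γ_{K_v}`; the definitional bridge to `discreteTopRep`
  let ρ : ContinuousRep G ℤ B :=
    { toRepresentation := (discreteContRep G B).toRepresentation
      continuous_smul := continuous_prod_of_discrete_right.mpr fun b ↦ hcont b }
  have hbridge : ∀ J : Subgroup G,
      (ρ.restrict (Literature.NumberTheory.GaloisRepresentations.subgroupIncl J)).toTopRep =
        discreteTopRep J B := fun _ ↦ rfl
  -- `H¹(I, B)` is finite of order `≤ #B`
  have hI : Finite (Literature.NumberTheory.EllipticCurves.subgroupH1 (𝔐.inertia G) B) ∧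
      Nat.card (Literature.NumberTheory.EllipticCurves.subgroupH1 (𝔐.inertia G) B) ≤ Nat.card B := by
    have h := natCard_continuousCohomology_one_absInertia_le (v.adicCompletion K) ρ hBcard
    rw [hbridge] at h
    rw [hIeq]
    exact h
  haveI := hI.1
  have hinj := resOfLe_inertia_injective κ hpv hns h𝔐 hle hB hcont
  exact ⟨Finite.of_injective _ hinj, (Nat.card_le_card_of_injective _ hinj).trans hI.2⟩

end Summit.BirchSwinnertonDyer.Rank1Residual.Iwasawa.NonsplitTower

end
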